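import Summits.BirchSwinnertonDyer.BirchSwinnertonDyer.Theorems.ResidualThetaTransportAtTwoThetaLayerLambdaCongruenceAtTwoWSideStabilization
import Summits.BirchSwinnertonDyer.BirchSwinnertonDyer.Theorems.ResidualThetaTransportAtTwoThetaLayerLambdaCongruenceAtTwoDepletionExact
import Summits.BirchSwinnertonDyer.BirchSwinnertonDyer.Theorems.ResidualThetaTransportAtTwoThetaLayerLambdaCongruenceAtTwoCurveEulerHecke
import Summits.BirchSwinnertonDyer.BirchSwinnertonDyer.Theorems.ResidualThetaTransportAtTwoResidualThetaMainConjectureAtTwoEulerLayerK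
import Summits.BirchSwinnertonDyer.BirchSwinnertonDyer.Theorems.ResidualThetaTransportAtTwoThetaLayerLambdaCongruenceAtTwoStarCruxGlue
import HarnessLib

/-!
# Crux `ThetaLayerLambdaCongruenceAtTwo` (stmt-BirchSwinnertonDyer-20688, route ResidualThetaTransportAtTwo), line `birth`:
# the curve-side stub (μ-W₁) for EVERY admissible `S₀` from the `S₀`-FREE statement «`μ = 0` at one even layer for the
# UNDEPLETED plus symbol of `W`» (width seat bsd-wall-rtt-p3-w3 g4; `--supports stmt-BirchSwinnertonDyer-20688 --as helper`;
# closes nothing)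

HONEST FRAMING. THEOREMS ONLY; the research input is an explicit hypothesis spelled inline; nothing about any curve or form
is asserted; BSD is not proved by any of this.

WHAT. After w3 g3's `…StarCruxGlue` (p605109) the crux `ThetaLayerLambdaCongruenceAtTwo` follows from seven named Literature
facts and ONE research input, the registered stub (μ-W₁) `stub_curveDepletedSymbolMaxAtTwoPowerCusp` of line `birth`: for `W`
on the habitat⁺, its newform `f` and EVERY admissible `S₀` (`2 ∉ S₀ ⊇ bad(W)`), the `S₀`-DEPLETED rational plus symbol
`φ^{S₀}_W` attains its `2`-adic maximum over `ℚ` at a `2`-power cusp `γ^s/2^{n₁+2}` of some EVEN layer `n₁`.  This file proves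
(μ-W₁) VERBATIM from the `S₀`-FREE statement

  (PR₂)  `∃ n₁` even, `∃ s`, `∀ r ∈ ℚ`: `‖[r]⁺_f‖₂ ≤ ‖[γ^s/2^{n₁+2}]⁺_f‖₂`   (the UNDEPLETED plus symbol of `W`'s newform),

i.e. «`μ(ϑ_{n₁}(f)) = 0` at one even layer in Pollack–Weston's cohomological normalisation» — the Perrin-Riou / Pollack
conjecture `μ^± = 0` at the supersingular prime `2` (even branch) for the curve `W` ALONE ([PollackWeston2011MT] Rem. 4.2.1;
OPEN in print — 2025: only `μ^± ≤ 2` for all but finitely many `p`, arXiv:2409.18021), a SINGLE finite modular-symbol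
computation per curve (no quantifier over `S₀`).

PROOF (`curveDepletedSymbolMaxAtTwoPowerCusp_of_undepleted`, §5).  Let `V = ‖[γ^{s₁}/2^{n₁+2}]⁺_f‖` be the maximum.
(a) Every depleted value has norm `≤ V` (§4: integral depletion coefficients, ultrametric).  (b) `θ_n(f)^{alg} = C 2·ϑ_n` with
`‖ϑ_n‖_sup = max_s ‖[γ^s/2^{n+2}]⁺_f‖` (doubling + isometry, w2/w3 g0), so `‖θ_{n₁}‖_sup = ‖2‖V`, and by the three-term
monotonicity (`wSide_supNorm_le_add_two` at `S₀ = ∅`) `‖θ_{n₁+2k}‖_sup = ‖2‖V` for all `k`; hence the `λ`-growth law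
`3λ(θ_{n₁+2k}) + 2^{n₁} = 3λ(θ_{n₁}) + 2^{n₁}4^k` (`wSide_growth_mul_of_stabilized`).  (c) The layer Euler product
`E_n = ∏_{v∈S₀} L_v(W,X)∘(ℓ_v⁻¹(X+1)^{e_{v,n}})` is non-zero of sup norm `1` with `λ(E_n) ≤ ∑_v 2^{ord₂((ℓ_v²−1)/8)+1}` BOUNDED in
`n` (§3, from rtt-p2's `layerEulerFactorK_two` — Greenberg–Vatsal Prop. (2.4) at the layer — via `L_v(W,X) = 1 − a_ℓ(W)X +
𝟙_{ℓ∤N_W}ℓX²`).  (d) `λ`-ROOM (§1): `λ(θ_n E_n) = λ(θ_n) + λ(E_n) < 2ⁿ` at some `n = n₁ + 2k` (the growth law leaves room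
`≈ 2·2ⁿ/3`), so reduction modulo `ω_n` preserves the sup norm (`supNorm_modByMonic_layerModulus_eq_iff`, w3 g0):
`‖Θ^{S₀}_n(W)‖_sup = ‖θ_n‖·‖E_n‖ = ‖2‖V`.  (e) `Θ^{S₀}_n(W) = C 2·∑_s φ^{S₀}_W(γ^s/2^{n+2})(X+1)^s`
(`depletedCurveLayer_eq_layerSum_depletedSymbol`, w2), so some depleted layer-`n` symbol has norm `V ≥` every depleted value.
§6 re-threads w3 g3's crux composition: THE CRUX BY NAME from the seven named facts + (PR₂).

References: [PollackWeston2011MT] §3.1, Thm. 4.1, Rem. 4.2; [GreenbergVatsal2000] §1 (8)/(10), §2 Prop. (2.4);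
[MazurTateTeitelbaum1986Invent] §I.13.
-/

noncomputable section

-- justification: the `Summit.BirchSwinnertonDyer.BirchSwinnertonDyer.…` path repeats a component (route-file convention)
set_option linter.dupNamespace false

open scoped Classical

open Polynomial Literature.NumberTheory.IwasawaTheory Literature.NumberTheory.EllipticCurves
  Literature.NumberTheory.EllipticCurves.ModularForms

namespace Summit.BirchSwinnertonDyer.BirchSwinnertonDyer.Theorems.ThetaLayerLambdaCongruenceAtTwo

/-! ## §1. The abstract `λ`-room lemma -/

section Room

/-- **`λ`-room.** Let `θ_{n₁+2k}` (`k ≥ 0`) be non-zero polynomials over `ℚ̄₂` of CONSTANT sup norm `c > 0` obeying the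
growth law `3λ(θ_{n₁+2k}) + 2^{n₁} = 3λ(θ_{n₁}) + 2^{n₁}·4^k` with `λ(θ_{n₁}) < 2^{n₁}`, and let `E_n` (`n ≥ N`) be non-zero of
sup norm `1` with BOUNDED `λ(E_n) ≤ B`.  Then at some layer `n = n₁ + 2k` the product survives reduction modulo
`ω_n = (X+1)^{2ⁿ} − 1` with full sup norm: `‖(θ_n·E_n) %ₘ ω_n‖_sup = c` — because `λ(θ_n·E_n) = λ(θ_n) + λ(E_n)` (Gauss) stays
below `2ⁿ` (the growth law leaves room `≈ 2·2ⁿ/3`), and reduction modulo `ω_n` preserves the sup norm iff `λ < 2ⁿ`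
(`supNorm_modByMonic_layerModulus_eq_iff`). [cite: PollackWeston2011MT, §3.1 and Thm. 4.1 (λ(θ_n) = q_n + λ; shape, read at 2)] -/
theorem exists_supNorm_modByMonic_mul_eq_of_growth {θ E : ℕ → (PadicAlgCl 2)[X]} {n₁ : ℕ} {c : ℝ} (hc : 0 < c)
    (hsup : ∀ k : ℕ, (θ (n₁ + 2 * k)).supNorm = c) (hlam₁ : layerLambda (θ n₁) < 2 ^ n₁)
    (hgrowth : ∀ k : ℕ, 3 * layerLambda (θ (n₁ + 2 * k)) + 2 ^ n₁ = 3 * layerLambda (θ n₁) + 2 ^ n₁ * 4 ^ k)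
    {N B : ℕ} (hE : ∀ n : ℕ, N ≤ n → E n ≠ 0 ∧ (E n).supNorm = 1 ∧ layerLambda (E n) ≤ B) :
    ∃ k : ℕ, N ≤ n₁ + 2 * k ∧
      ((θ (n₁ + 2 * k) * E (n₁ + 2 * k)) %ₘ ((X + 1) ^ 2 ^ (n₁ + 2 * k) - 1)).supNorm = c := by
  set k : ℕ := N + 3 * B + 2 with hk
  have hNk : N ≤ n₁ + 2 * k := by omega
  obtain ⟨hE0, hE1, hEB⟩ := hE (n₁ + 2 * k) hNk
  have hθ0 : θ (n₁ + 2 * k) ≠ 0 := fun h ↦ by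
    have := hsup k
    rw [h, supNorm_zero] at this
    exact hc.ne' this.symm |>.elim
  refine ⟨k, hNk, ?_⟩
  have hroom : layerLambda (θ (n₁ + 2 * k) * E (n₁ + 2 * k)) < 2 ^ (n₁ + 2 * k) := by
    rw [layerLambda_mul hθ0 hE0]
    have hP : k < 4 ^ k := Nat.lt_pow_self (by norm_num)
    have hpow : 2 ^ (n₁ + 2 * k) = 2 ^ n₁ * 4 ^ k := by
      rw [pow_add, pow_mul]; norm_num
    rw [hpow]
    have hA : 1 ≤ 2 ^ n₁ := Nat.one_le_two_pow
    -- linearise: Q = 2^{n₁}·4^k, R = 2^{n₁}·B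
    have hQ : 2 ^ n₁ * (3 * B + 2) ≤ 2 ^ n₁ * 4 ^ k := Nat.mul_le_mul_left _ (by omega)
    have hR : B ≤ 2 ^ n₁ * B := Nat.le_mul_of_pos_left B hA
    have hg := hgrowth k
    have hexp : 2 ^ n₁ * (3 * B + 2) = 3 * (2 ^ n₁ * B) + 2 * 2 ^ n₁ := by ring
    rw [hexp] at hQ
    omega
  rw [(supNorm_modByMonic_layerModulus_eq_iff (p := 2) (n₁ + 2 * k) (mul_ne_zero hθ0 hE0)).mpr hroom,
    supNorm_mul', hsup k, hE1, mul_one]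

end Room

/-! ## §2. Products: sup norm and `λ` -/

section Products

variable {K : Type*} [NormedField K] [IsUltrametricDist K]

/-- `‖∏ F_i‖_sup = 1` when every `‖F_i‖_sup = 1` (Gauss norm is multiplicative). [folklore] -/
theorem supNorm_prod_eq_one {α : Type*} (s : Finset α) (F : α → K[X]) (h : ∀ i ∈ s, (F i).supNorm = 1) :
    (∏ i ∈ s, F i).supNorm = 1 := by
  classical
  induction s using Finset.induction_on with
  | empty => rw [Finset.prod_empty, ← C_1, supNorm_C, norm_one]
  | insert a s ha ih =>
    rw [Finset.prod_insert ha, supNorm_mul', h a (Finset.mem_insert_self a s),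
      ih (fun i hi ↦ h i (Finset.mem_insert_of_mem hi)), one_mul]

/-- `λ(∏ F_i) = ∑ λ(F_i)` for non-zero polynomials over a valued field (Gauss lemma with `λ`). [cite: PollackWeston2011MT, §3.1] -/
theorem layerLambda_prod_eq_sum {α : Type*} (s : Finset α) (F : α → K[X]) (h : ∀ i ∈ s, F i ≠ 0) :
    layerLambda (∏ i ∈ s, F i) = ∑ i ∈ s, layerLambda (F i) := by
  classical
  induction s using Finset.induction_on with
  | empty =>
    rw [Finset.prod_empty, Finset.sum_empty]
    exact Nat.eq_zero_of_le_zero ((layerLambda_le_natDegree one_ne_zero).trans natDegree_one.le)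
  | insert a s ha ih =>
    rw [Finset.prod_insert ha, Finset.sum_insert ha,
      layerLambda_mul (h a (Finset.mem_insert_self a s))
        (Finset.prod_ne_zero_iff.mpr fun i hi ↦ h i (Finset.mem_insert_of_mem hi)),
      ih (fun i hi ↦ h i (Finset.mem_insert_of_mem hi))]

end Products

/-! ## §3. The `W`-side Euler product at the layers: non-zero, sup norm `1`, BOUNDED `λ` -/

section Euler

variable (W : WeierstrassCurve ℚ) [W.IsElliptic] [W.IsGloballyMinimal]
  (S₀ : Finset (IsDedekindDomain.HeightOneSpectrum (NumberField.RingOfIntegers ℚ)))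

/-- **The curve's layer Euler product has `μ = 0` and BOUNDED `λ`.** For `S₀` off `2` and every layer
`n > max_{v∈S₀} ord₂((ℓ_v²−1)/8)`: `E^W_n = ∏_{v∈S₀} L_v(W,X)∘(ℓ_v⁻¹(X+1)^{e_{v,n}})` is non-zero, `‖E^W_n‖_sup = 1`, and
`λ(E^W_n) ≤ ∑_{v∈S₀} 2^{ord₂((ℓ_v²−1)/8)+1}` — a bound INDEPENDENT of `n` (each factor is the partner-type Euler factor of
`…ResidualThetaMainConjectureAtTwoEulerLayerK.layerEulerFactorK_two` with `a = a_ℓ(W) ∈ ℤ`, since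
`L_v(W,X) = 1 − a_ℓ(W)X + 𝟙_{ℓ∤N_W} ℓX²`, `map_localPolynomialAt_eq`; its `λ` is `2^{n_ℓ}·d` with `d ≤ 2`).
[cite: GreenbergVatsal2000, §2 Prop. (2.4) (p. 22)] -/
theorem wEulerProduct_layer_facts (hS2 : ∀ v ∈ S₀, ((2 : ℕ) : NumberField.RingOfIntegers ℚ) ∉ v.asIdeal) {n : ℕ}
    (hn : S₀.sup (fun v ↦ padicValNat 2 ((Rat.HeightOneSpectrum.natGenerator v ^ 2 - 1) / 8)) < n) :
    (∏ v ∈ S₀, ((W.localPolynomialAt v).map (Int.castRingHom (PadicAlgCl 2))).comp (C ((Rat.HeightOneSpectrum.natGenerator v : PadicAlgCl 2)⁻¹) * (X + 1) ^ (PadicInt.toZModPow n (-(GreenbergVatsal2000.frobeniusExponent 2 (Rat.HeightOneSpectrum.natGenerator v : ℤ_[2])))).val)) ≠ 0 ∧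
    (∏ v ∈ S₀, ((W.localPolynomialAt v).map (Int.castRingHom (PadicAlgCl 2))).comp (C ((Rat.HeightOneSpectrum.natGenerator v : PadicAlgCl 2)⁻¹) * (X + 1) ^ (PadicInt.toZModPow n (-(GreenbergVatsal2000.frobeniusExponent 2 (Rat.HeightOneSpectrum.natGenerator v : ℤ_[2])))).val)).supNorm = 1 ∧
    layerLambda (∏ v ∈ S₀, ((W.localPolynomialAt v).map (Int.castRingHom (PadicAlgCl 2))).comp (C ((Rat.HeightOneSpectrum.natGenerator v : PadicAlgCl 2)⁻¹) * (X + 1) ^ (PadicInt.toZModPow n (-(GreenbergVatsal2000.frobeniusExponent 2 (Rat.HeightOneSpectrum.natGenerator v : ℤ_[2])))).val)) ≤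
      ∑ v ∈ S₀, 2 ^ (padicValNat 2 ((Rat.HeightOneSpectrum.natGenerator v ^ 2 - 1) / 8) + 1) := by
  -- each factor, through the partner-type shape `(1 − aX + 𝟙_{ℓ∤N_W} ℓX²)∘(ℓ⁻¹(X+1)^e)` with `a = a_ℓ(W)`
  have hfac : ∀ v ∈ S₀,
      ((W.localPolynomialAt v).map (Int.castRingHom (PadicAlgCl 2))).comp (C ((Rat.HeightOneSpectrum.natGenerator v : PadicAlgCl 2)⁻¹) * (X + 1) ^ (PadicInt.toZModPow n (-(GreenbergVatsal2000.frobeniusExponent 2 (Rat.HeightOneSpectrum.natGenerator v : ℤ_[2])))).val) ≠ 0 ∧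
      (((W.localPolynomialAt v).map (Int.castRingHom (PadicAlgCl 2))).comp (C ((Rat.HeightOneSpectrum.natGenerator v : PadicAlgCl 2)⁻¹) * (X + 1) ^ (PadicInt.toZModPow n (-(GreenbergVatsal2000.frobeniusExponent 2 (Rat.HeightOneSpectrum.natGenerator v : ℤ_[2])))).val)).supNorm = 1 ∧
      layerLambda (((W.localPolynomialAt v).map (Int.castRingHom (PadicAlgCl 2))).comp (C ((Rat.HeightOneSpectrum.natGenerator v : PadicAlgCl 2)⁻¹) * (X + 1) ^ (PadicInt.toZModPow n (-(GreenbergVatsal2000.frobeniusExponent 2 (Rat.HeightOneSpectrum.natGenerator v : ℤ_[2])))).val)) ≤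
        2 ^ (padicValNat 2 ((Rat.HeightOneSpectrum.natGenerator v ^ 2 - 1) / 8) + 1) := by
    intro v hv
    have hℓ : Rat.HeightOneSpectrum.natGenerator v ≠ 2 := fun h ↦
      not_two_dvd_natGenerator (hS2 v hv) (by rw [h])
    have ha : ‖((W.LFunction (Rat.HeightOneSpectrum.natGenerator v) : ℤ) : PadicAlgCl 2)‖ ≤ 1 := by
      rw [← map_intCast (algebraMap ℚ_[2] (PadicAlgCl 2)), PadicAlgCl.norm_extends]
      exact Padic.norm_int_le_one _
    have hnv : padicValNat 2 ((Rat.HeightOneSpectrum.natGenerator v ^ 2 - 1) / 8) < n :=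
      lt_of_le_of_lt (Finset.le_sup (f := fun v ↦ padicValNat 2 ((Rat.HeightOneSpectrum.natGenerator v ^ 2 - 1) / 8)) hv) hn
    obtain ⟨h0, h1, hlam⟩ := Summit.BirchSwinnertonDyer.BirchSwinnertonDyer.Theorems.ResidualThetaLayer.layerEulerFactorK_two
      (W.conductorNorm ℤ) v ((W.LFunction (Rat.HeightOneSpectrum.natGenerator v) : ℤ) : PadicAlgCl 2) hℓ ha hnv
    rw [map_localPolynomialAt_eq W v]
    refine ⟨h0, h1, ?_⟩
    rw [hlam, pow_succ]
    refine Nat.mul_le_mul_left _ ?_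
    split_ifs <;> omega
  refine ⟨Finset.prod_ne_zero_iff.mpr fun v hv ↦ (hfac v hv).1,
    supNorm_prod_eq_one S₀ _ fun v hv ↦ (hfac v hv).2.1, ?_⟩
  rw [layerLambda_prod_eq_sum S₀ _ fun v hv ↦ (hfac v hv).1]
  exact Finset.sum_le_sum fun v hv ↦ (hfac v hv).2.2

end Euler

/-! ## §4. The depleted symbol is bounded by the undepleted one -/

section Bound

variable (W : WeierstrassCurve ℚ) {N : ℕ} (f : CuspForm (CongruenceSubgroup.Gamma0 N) 2)
  (S₀ : Finset (IsDedekindDomain.HeightOneSpectrum (NumberField.RingOfIntegers ℚ)))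

/-- **`‖φ^{S₀}_W(x)‖ ≤ sup_r ‖[r]⁺_f‖`**: the `S₀`-depleted rational plus symbol (exact form of the crux) is an integral
combination of undepleted plus symbols — the coefficients `∏_v coeff_{k_v}(L_v(W,X))·ℓ_v^{−k_v}` are `2`-adic integers for
`S₀` off `2` — so every bound `V` for the undepleted `2`-adic plus symbols bounds the depleted one (ultrametric).
[cite: GreenbergVatsal2000, §1 p. 9 (display (8); shape)] -/
theorem norm_depletedCurveSymbol_le_of_forall_le (hS2 : ∀ v ∈ S₀, ((2 : ℕ) : NumberField.RingOfIntegers ℚ) ∉ v.asIdeal)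
    {V : ℝ} (hV : ∀ r : ℚ, ‖algebraMap ℚ (PadicAlgCl 2) (ratPlusSymbol f r)‖ ≤ V) (x : ℚ) :
    ‖(∑ k ∈ Fintype.piFinset (fun _ : S₀ ↦ Finset.range 3), (∏ v : S₀, ((W.localPolynomialAt (v : IsDedekindDomain.HeightOneSpectrum (NumberField.RingOfIntegers ℚ))).map (Int.castRingHom (PadicAlgCl 2))).coeff (k v) * ((Rat.HeightOneSpectrum.natGenerator (v : IsDedekindDomain.HeightOneSpectrum (NumberField.RingOfIntegers ℚ)) : PadicAlgCl 2)⁻¹) ^ (k v)) * algebraMap ℚ (PadicAlgCl 2) (ratPlusSymbol f (x * ((∏ v : S₀, Rat.HeightOneSpectrum.natGenerator (v : IsDedekindDomain.HeightOneSpectrum (NumberField.RingOfIntegers ℚ)) ^ (k v) : ℕ) : ℚ))))‖ ≤ V := by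
  have hV0 : 0 ≤ V := (norm_nonneg _).trans (hV 0)
  refine norm_sum_le_of_forall_le' hV0 fun k _ ↦ ?_
  rw [norm_mul]
  refine (mul_le_of_le_one_left (norm_nonneg _) ?_).trans (hV _)
  rw [norm_prod]
  refine Finset.prod_le_one (fun v _ ↦ norm_nonneg _) fun v _ ↦ ?_
  rw [norm_mul, norm_pow, norm_inv, norm_natCast_padicAlgCl_two_eq_one (not_two_dvd_natGenerator (hS2 v v.2)), inv_one,
    one_pow, mul_one, coeff_map, eq_intCast, ← map_intCast (algebraMap ℚ_[2] (PadicAlgCl 2)), PadicAlgCl.norm_extends]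
  exact Padic.norm_int_le_one _

end Bound

/-! ## §5. (μ-W₁) for every admissible `S₀` from the `S₀`-free undepleted statement -/

section Main

/-- **(μ-W₁) FROM THE `S₀`-FREE `μ = 0` STATEMENT.**  Hypothesis (PR₂), spelled inline: on the habitat⁺, for the newform `f`
of `W`, there is an EVEN layer `n₁` and a `2`-power cusp `γ^s/2^{n₁+2}` at which the UNDEPLETED `2`-adic rational plus
symbol `[·]⁺_f` attains its maximum norm over `ℚ` (in Pollack–Weston's cohomological normalisation: `μ(ϑ_{n₁}(f)) = 0` at
one even layer — the Perrin-Riou / Pollack conjecture `μ^± = 0` at the supersingular prime `2`, even branch;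
[PollackWeston2011MT] Rem. 4.2.1, OPEN in print).  Conclusion: the registered stub (μ-W₁)
`stub_curveDepletedSymbolMaxAtTwoPowerCusp` of line `birth` VERBATIM, for EVERY admissible `S₀` — the `S₀`-DEPLETED symbol
also attains its maximum at a `2`-power cusp of some even layer.  PROOF: the undepleted sup norm propagates up the even
layers (`wSide_supNorm_le_add_two` at `S₀ = ∅`) and stays at the maximum `‖2‖·V`, so the `λ`-growth law holds from `n₁`
(`wSide_growth_mul_of_stabilized`); the layer Euler product has sup norm `1` and BOUNDED `λ` (§3); by `λ`-room (§1) some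
even layer `n = n₁ + 2k` has `‖Θ^{S₀}_n(W)‖_sup = ‖2‖·V`, i.e. (`depletedCurveLayer_eq_layerSum_depletedSymbol` + the
isometry) a depleted symbol at a layer-`n` cusp of norm `V ≥` every depleted value (§4).
[cite: PollackWeston2011MT, Rem. 4.2.1 and Thm. 4.1 (conjecture μ^± = 0; λ(θ_n) = q_n + λ^±; read at p = 2)]
[cite: GreenbergVatsal2000, §2 Prop. (2.4) (imprimitive elements: μ unchanged, λ shifts by the Euler factors)] -/
theorem curveDepletedSymbolMaxAtTwoPowerCusp_of_undepleted
    (hPR : ∀ (W : WeierstrassCurve ℚ) [W.IsElliptic] [W.IsGloballyMinimal], ¬ W.HasCM → W.analyticRank = 0 → Literature.NumberTheory.EllipticCurves.Rank1Residual.GoodSS W 2 → W.frobeniusTrace 2 = 0 → W.Δ < 0 → ∀ [NeZero (W.conductorNorm ℤ)] (f : CuspForm (CongruenceSubgroup.Gamma0 (W.conductorNorm ℤ)) 2), Literature.NumberTheory.EllipticCurves.ModularForms.IsNewformOf W f → ∃ n₁ : ℕ, Even n₁ ∧ ∃ s : ZMod (2 ^ n₁), ∀ r : ℚ, ‖algebraMap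 ℚ (PadicAlgCl 2) (ratPlusSymbol f r)‖ ≤ ‖algebraMap ℚ (PadicAlgCl 2) (ratPlusSymbol f ((((Literature.NumberTheory.EllipticCurves.cyclotomicGenerator 2 : ZMod (2 ^ (n₁ + 2))) ^ s.val).val : ℚ) / (2 : ℚ) ^ (n₁ + 2)))‖) :
    ∀ (W : WeierstrassCurve ℚ) [W.IsElliptic] [W.IsGloballyMinimal], ¬ W.HasCM → W.analyticRank = 0 → Literature.NumberTheory.EllipticCurves.Rank1Residual.GoodSS W 2 → W.frobeniusTrace 2 = 0 → W.Δ < 0 → ∀ [NeZero (W.conductorNorm ℤ)] (f : CuspForm (CongruenceSubgroup.Gamma0 (W.conductorNorm ℤ)) 2), Literature.NumberTheory.EllipticCurves.ModularForms.IsNewformOf W f → ∀ (S₀ : Finset (IsDedekindDomain.HeightOneSpectrum (NumberField.RingOfIntegers ℚ))), (∀ v ∈ S₀, ((2 : ℕ) : NumberField.RingOfIntegers ℚ) ∉ v.asIdeal) → (∀ v : IsDedekindDomain.HeightOneSpectrum (NumberField.RingOfIntegers ℚ), ¬ W.HasGoodReductionAt v → v ∈ S₀) → ∃ n₁ : ℕ,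 Even n₁ ∧ ∃ s : ZMod (2 ^ n₁), ∀ r : ℚ, ‖(∑ k ∈ Fintype.piFinset (fun _ : S₀ ↦ Finset.range 3), (∏ v : S₀, ((W.localPolynomialAt (v : IsDedekindDomain.HeightOneSpectrum (NumberField.RingOfIntegers ℚ))).map (Int.castRingHom (PadicAlgCl 2))).coeff (k v) * ((Rat.HeightOneSpectrum.natGenerator (v : IsDedekindDomain.HeightOneSpectrum (NumberField.RingOfIntegers ℚ)) : PadicAlgCl 2)⁻¹) ^ (k v)) * algebraMap ℚ (PadicAlgCl 2) (ratPlusSymbol f (r * ((∏ v : S₀, Rat.HeightOneSpectrum.natGenerator (v : IsDedekindDomain.HeightOneSpectrum (NumberField.RingOfIntegers ℚ)) ^ (k v) : ℕ) : ℚ))))‖ ≤ ‖(∑ k ∈ Fintype.piFinset (fun _ : S₀ ↦ Finset.range 3), (∏ v : S₀, ((W.localPolynomialAt (v : IsDedekindDomain.HeightOneSpectrum (NumberField.RingOfIntegers ℚ))).map (Int.castRingHom (PadicAlgCl 2))).coeff (k v) * ((Rat.HeightOneSpectrum.natGenerator (v : IsDedekindDomain.HeightOneSpectrum (NumberField.RingOfIntegers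 ℚ)) : PadicAlgCl 2)⁻¹) ^ (k v)) * algebraMap ℚ (PadicAlgCl 2) (ratPlusSymbol f ((((((Literature.NumberTheory.EllipticCurves.cyclotomicGenerator 2 : ZMod (2 ^ (n₁ + 2))) ^ s.val).val : ℚ) / (2 : ℚ) ^ (n₁ + 2))) * ((∏ v : S₀, Rat.HeightOneSpectrum.natGenerator (v : IsDedekindDomain.HeightOneSpectrum (NumberField.RingOfIntegers ℚ)) ^ (k v) : ℕ) : ℚ))))‖ := by
  intro W _ _ hcm hr hss ha hΔ _ f hf S₀ hS2 _
  obtain ⟨n₁, hn₁e, s₁, hmax⟩ := hPR W hcm hr hss ha hΔ f hf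
  haveI : NeZero (2 ^ n₁) := ⟨pow_ne_zero _ two_ne_zero⟩
  -- the maximum `V` of the undepleted symbol
  set V : ℝ := ‖algebraMap ℚ (PadicAlgCl 2) (ratPlusSymbol f ((((Literature.NumberTheory.EllipticCurves.cyclotomicGenerator 2 : ZMod (2 ^ (n₁ + 2))) ^ s₁.val).val : ℚ) / (2 : ℚ) ^ (n₁ + 2)))‖ with hVdef
  have hbound : ∀ (x : ℚ), ‖(∑ k ∈ Fintype.piFinset (fun _ : S₀ ↦ Finset.range 3), (∏ v : S₀, ((W.localPolynomialAt (v : IsDedekindDomain.HeightOneSpectrum (NumberField.RingOfIntegers ℚ))).map (Int.castRingHom (PadicAlgCl 2))).coeff (k v) * ((Rat.HeightOneSpectrum.natGenerator (v : IsDedekindDomain.HeightOneSpectrum (NumberField.RingOfIntegers ℚ)) : PadicAlgCl 2)⁻¹) ^ (k v)) * algebraMap ℚ (PadicAlgCl 2) (ratPlusSymbol f (x * ((∏ v : S₀, Rat.HeightOneSpectrum.natGenerator (v : IsDedekindDomain.HeightOneSpectrum (NumberField.RingOfIntegers ℚ)) ^ (k v) : ℕ) : ℚ))))‖ ≤ V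 := fun x ↦
    norm_depletedCurveSymbol_le_of_forall_le W f S₀ hS2 hmax x
  rcases (norm_nonneg (algebraMap ℚ (PadicAlgCl 2) (ratPlusSymbol f ((((Literature.NumberTheory.EllipticCurves.cyclotomicGenerator 2 : ZMod (2 ^ (n₁ + 2))) ^ s₁.val).val : ℚ) / (2 : ℚ) ^ (n₁ + 2))))).eq_or_lt with hV0 | hVpos
  · -- degenerate case: the undepleted symbol vanishes identically, hence so does the depleted one
    refine ⟨n₁, hn₁e, s₁, fun r ↦ ?_⟩
    exact ((hbound r).trans_eq hV0.symm).trans (norm_nonneg _)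
  · have h2pos : 0 < ‖(2 : PadicAlgCl 2)‖ := norm_pos_iff.mpr two_ne_zero
    -- (1) the undepleted element `U n = θ_n(f)^alg` is `C 2 ·` the layer sum of the undepleted symbols
    have hU : ∀ n : ℕ, (((Literature.NumberTheory.EllipticCurves.mazurTateElement f 2 (n)).map (algebraMap ℚ (PadicAlgCl 2)))).supNorm = ‖(2 : PadicAlgCl 2)‖ * (∑ s : ZMod (2 ^ (n)), Polynomial.C (algebraMap ℚ (PadicAlgCl 2) (ratPlusSymbol f ((((Literature.NumberTheory.EllipticCurves.cyclotomicGenerator 2 : ZMod (2 ^ (n + 2))) ^ s.val).val : ℚ) / (2 : ℚ) ^ (n + 2)))) * (Polynomial.X + 1) ^ s.val).supNorm := fun n ↦ by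
      rw [map_mazurTateElement_two f n, supNorm_C_mul]
    -- (2) `‖U n‖_sup ≤ ‖2‖·V` for every `n`, with equality at `n₁`
    have hUle : ∀ n : ℕ, (((Literature.NumberTheory.EllipticCurves.mazurTateElement f 2 (n)).map (algebraMap ℚ (PadicAlgCl 2)))).supNorm ≤ ‖(2 : PadicAlgCl 2)‖ * V := fun n ↦ by
      haveI : NeZero (2 ^ n) := ⟨pow_ne_zero _ two_ne_zero⟩
      rw [hU n]
      refine mul_le_mul_of_nonneg_left ?_ (norm_nonneg _)
      exact (supNorm_sum_C_mul_X_add_one_pow_le_iff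
        (fun s : ZMod (2 ^ n) ↦ algebraMap ℚ (PadicAlgCl 2) (ratPlusSymbol f ((((Literature.NumberTheory.EllipticCurves.cyclotomicGenerator 2 : ZMod (2 ^ (n + 2))) ^ s.val).val : ℚ) / (2 : ℚ) ^ (n + 2)))) hVpos.le).mpr
        fun t ↦ hmax _
    have hU₁ : (((Literature.NumberTheory.EllipticCurves.mazurTateElement f 2 (n₁)).map (algebraMap ℚ (PadicAlgCl 2)))).supNorm = ‖(2 : PadicAlgCl 2)‖ * V := by
      refine le_antisymm (hUle n₁) ?_
      rw [hU n₁]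
      exact mul_le_mul_of_nonneg_left (norm_le_supNorm_sum_C_mul_X_add_one_pow
        (fun s : ZMod (2 ^ n₁) ↦ algebraMap ℚ (PadicAlgCl 2) (ratPlusSymbol f ((((Literature.NumberTheory.EllipticCurves.cyclotomicGenerator 2 : ZMod (2 ^ (n₁ + 2))) ^ s.val).val : ℚ) / (2 : ℚ) ^ (n₁ + 2)))) s₁) (norm_nonneg _)
    have hU0 : ((Literature.NumberTheory.EllipticCurves.mazurTateElement f 2 (n₁)).map (algebraMap ℚ (PadicAlgCl 2))) ≠ 0 := fun h ↦ by
      have h' := hU₁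
      rw [h, supNorm_zero] at h'
      exact (mul_pos h2pos hVpos).ne h'
    -- (3) the crux's `W`-element at `S₀ = ∅` IS `U n`
    have hDempty : ∀ n : ℕ, ((((Literature.NumberTheory.EllipticCurves.mazurTateElement f 2 (n)).map (algebraMap ℚ (PadicAlgCl 2))) * ∏ v ∈ (∅ : Finset (IsDedekindDomain.HeightOneSpectrum (NumberField.RingOfIntegers ℚ))), ((W.localPolynomialAt v).map (Int.castRingHom (PadicAlgCl 2))).comp (Polynomial.C ((Rat.HeightOneSpectrum.natGenerator v : PadicAlgCl 2)⁻¹) * (Polynomial.X + 1) ^ (PadicInt.toZModPow (n) (-(Literature.NumberTheory.EllipticCurves.GreenbergVatsal2000.frobeniusExponent 2 (Rat.HeightOneSpectrum.natGenerator v : ℤ_[2])))).val)) %ₘ ((Polynomial.X + 1) ^ 2 ^ (n) - 1)) = ((Literature.NumberTheory.EllipticCurves.mazurTateElement f 2 (n)).map (algebraMap ℚ (PadicAlgCl 2))) := fun n ↦ by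
      rw [Finset.prod_empty, mul_one, map_mazurTateElement_two f n, C_mul', smul_modByMonic]
      have hfix := layerSum_modByMonic_layerModulus (K := PadicAlgCl 2)
        (fun t : ℕ ↦ algebraMap ℚ (PadicAlgCl 2) (ratPlusSymbol f ((((Literature.NumberTheory.EllipticCurves.cyclotomicGenerator 2 : ZMod (2 ^ (n + 2))) ^ t).val : ℚ) / (2 : ℚ) ^ (n + 2)))) n
      beta_reduce at hfix
      rw [hfix]
    -- (4) monotonicity along the even layers (three-term relation, `S₀ = ∅` instance) ⟹ constancy at `‖2‖·V` from `n₁`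
    have hmono : ∀ n : ℕ, (((Literature.NumberTheory.EllipticCurves.mazurTateElement f 2 (n)).map (algebraMap ℚ (PadicAlgCl 2)))).supNorm ≤ (((Literature.NumberTheory.EllipticCurves.mazurTateElement f 2 (n + 2)).map (algebraMap ℚ (PadicAlgCl 2)))).supNorm := fun n ↦ by
      have h := wSide_supNorm_le_add_two (∅ : Finset (IsDedekindDomain.HeightOneSpectrum (NumberField.RingOfIntegers ℚ)))
        hss ha hf n
      rwa [hDempty n, hDempty (n + 2)] at h
    have hUk : ∀ k : ℕ, (((Literature.NumberTheory.EllipticCurves.mazurTateElement f 2 (n₁ + 2 * k)).map (algebraMap ℚ (PadicAlgCl 2)))).supNorm = ‖(2 : PadicAlgCl 2)‖ * V := by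
      intro k
      induction k with
      | zero => simpa using hU₁
      | succ k ih =>
        refine le_antisymm (hUle _) ?_
        have e : n₁ + 2 * (k + 1) = n₁ + 2 * k + 2 := by ring
        rw [e, ← ih]
        exact hmono _
    -- (5) the `λ`-growth law from `n₁` (stabilised at the maximum), `S₀ = ∅` instance
    have hgrowth : ∀ k : ℕ, 3 * layerLambda ((Literature.NumberTheory.EllipticCurves.mazurTateElement f 2 (n₁ + 2 * k)).map (algebraMap ℚ (PadicAlgCl 2))) + 2 ^ n₁ =
        3 * layerLambda ((Literature.NumberTheory.EllipticCurves.mazurTateElement f 2 (n₁)).map (algebraMap ℚ (PadicAlgCl 2))) + 2 ^ n₁ * 4 ^ k := by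
      intro k
      have h0' : ((((Literature.NumberTheory.EllipticCurves.mazurTateElement f 2 (n₁)).map (algebraMap ℚ (PadicAlgCl 2))) * ∏ v ∈ (∅ : Finset (IsDedekindDomain.HeightOneSpectrum (NumberField.RingOfIntegers ℚ))), ((W.localPolynomialAt v).map (Int.castRingHom (PadicAlgCl 2))).comp (Polynomial.C ((Rat.HeightOneSpectrum.natGenerator v : PadicAlgCl 2)⁻¹) * (Polynomial.X + 1) ^ (PadicInt.toZModPow (n₁) (-(Literature.NumberTheory.EllipticCurves.GreenbergVatsal2000.frobeniusExponent 2 (Rat.HeightOneSpectrum.natGenerator v : ℤ_[2])))).val)) %ₘ ((Polynomial.X + 1) ^ 2 ^ (n₁) - 1)) ≠ 0 := by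
        rw [hDempty n₁]; exact hU0
      have hst' : ∀ k : ℕ, (((((Literature.NumberTheory.EllipticCurves.mazurTateElement f 2 (n₁ + 2 * k + 2)).map (algebraMap ℚ (PadicAlgCl 2))) * ∏ v ∈ (∅ : Finset (IsDedekindDomain.HeightOneSpectrum (NumberField.RingOfIntegers ℚ))), ((W.localPolynomialAt v).map (Int.castRingHom (PadicAlgCl 2))).comp (Polynomial.C ((Rat.HeightOneSpectrum.natGenerator v : PadicAlgCl 2)⁻¹) * (Polynomial.X + 1) ^ (PadicInt.toZModPow (n₁ + 2 * k + 2) (-(Literature.NumberTheory.EllipticCurves.GreenbergVatsal2000.frobeniusExponent 2 (Rat.HeightOneSpectrum.natGenerator v : ℤ_[2])))).val)) %ₘ ((Polynomial.X + 1) ^ 2 ^ (n₁ + 2 * k + 2) - 1))).supNorm ≤ (((((Literature.NumberTheory.EllipticCurves.mazurTateElement f 2 (n₁ + 2 * k)).map (algebraMap ℚ (PadicAlgCl 2))) * ∏ v ∈ (∅ : Finset (IsDedekindDomain.HeightOneSpectrum (NumberField.RingOfIntegers ℚ))), ((W.localPolynomialAt v).map (Int.castRingHom (PadicAlgCl 2))).comp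 (Polynomial.C ((Rat.HeightOneSpectrum.natGenerator v : PadicAlgCl 2)⁻¹) * (Polynomial.X + 1) ^ (PadicInt.toZModPow (n₁ + 2 * k) (-(Literature.NumberTheory.EllipticCurves.GreenbergVatsal2000.frobeniusExponent 2 (Rat.HeightOneSpectrum.natGenerator v : ℤ_[2])))).val)) %ₘ ((Polynomial.X + 1) ^ 2 ^ (n₁ + 2 * k) - 1))).supNorm := fun k ↦ by
        have e : n₁ + 2 * k + 2 = n₁ + 2 * (k + 1) := by ring
        rw [hDempty, hDempty, e, hUk, hUk]
      have hg := wSide_growth_mul_of_stabilized (∅ : Finset (IsDedekindDomain.HeightOneSpectrum (NumberField.RingOfIntegers ℚ)))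
        hss ha hf h0' hst' k
      rwa [hDempty, hDempty] at hg
    -- (6) `λ(U n₁) < 2^{n₁}` (degree `< 2^{n₁}`)
    have hlam₁ : layerLambda ((Literature.NumberTheory.EllipticCurves.mazurTateElement f 2 (n₁)).map (algebraMap ℚ (PadicAlgCl 2))) < 2 ^ n₁ := by
      refine lt_of_le_of_lt (layerLambda_le_natDegree hU0) ?_
      have hdeg := natDegree_layerSum_lt (K := PadicAlgCl 2)
        (fun t : ℕ ↦ algebraMap ℚ (PadicAlgCl 2) (ratPlusSymbol f ((((Literature.NumberTheory.EllipticCurves.cyclotomicGenerator 2 : ZMod (2 ^ (n₁ + 2))) ^ t).val : ℚ) / (2 : ℚ) ^ (n₁ + 2)))) n₁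
      beta_reduce at hdeg
      rw [map_mazurTateElement_two f n₁]
      exact lt_of_le_of_lt (natDegree_C_mul_le _ _) hdeg
    -- (7) the layer Euler product: non-zero, sup norm `1`, bounded `λ` (§3)
    have hE : ∀ n : ℕ, S₀.sup (fun v ↦ padicValNat 2 ((Rat.HeightOneSpectrum.natGenerator v ^ 2 - 1) / 8)) + 1 ≤ n →
        (∏ v ∈ S₀, ((W.localPolynomialAt v).map (Int.castRingHom (PadicAlgCl 2))).comp (Polynomial.C ((Rat.HeightOneSpectrum.natGenerator v : PadicAlgCl 2)⁻¹) * (Polynomial.X + 1) ^ (PadicInt.toZModPow (n) (-(Literature.NumberTheory.EllipticCurves.GreenbergVatsal2000.frobeniusExponent 2 (Rat.HeightOneSpectrum.natGenerator v : ℤ_[2])))).val)) ≠ 0 ∧ ((∏ v ∈ S₀, ((W.localPolynomialAt v).map (Int.castRingHom (PadicAlgCl 2))).comp (Polynomial.C ((Rat.HeightOneSpectrum.natGenerator v : PadicAlgCl 2)⁻¹) * (Polynomial.X + 1) ^ (PadicInt.toZModPow (n) (-(Literature.NumberTheory.EllipticCurves.GreenbergVatsal2000.frobeniusExponent 2 (Rat.HeightOneSpectrum.natGenerator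 v : ℤ_[2])))).val))).supNorm = 1 ∧
        layerLambda (∏ v ∈ S₀, ((W.localPolynomialAt v).map (Int.castRingHom (PadicAlgCl 2))).comp (Polynomial.C ((Rat.HeightOneSpectrum.natGenerator v : PadicAlgCl 2)⁻¹) * (Polynomial.X + 1) ^ (PadicInt.toZModPow (n) (-(Literature.NumberTheory.EllipticCurves.GreenbergVatsal2000.frobeniusExponent 2 (Rat.HeightOneSpectrum.natGenerator v : ℤ_[2])))).val)) ≤ ∑ v ∈ S₀, 2 ^ (padicValNat 2 ((Rat.HeightOneSpectrum.natGenerator v ^ 2 - 1) / 8) + 1) :=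
      fun n hn ↦ wEulerProduct_layer_facts W S₀ hS2 (by omega)
    -- (8) `λ`-room (§1): some even layer `n = n₁ + 2k` at which the depleted element has full sup norm `‖2‖·V`
    obtain ⟨j, -, hj⟩ := exists_supNorm_modByMonic_mul_eq_of_growth
      (θ := fun n ↦ ((Literature.NumberTheory.EllipticCurves.mazurTateElement f 2 (n)).map (algebraMap ℚ (PadicAlgCl 2)))) (E := fun n ↦ (∏ v ∈ S₀, ((W.localPolynomialAt v).map (Int.castRingHom (PadicAlgCl 2))).comp (Polynomial.C ((Rat.HeightOneSpectrum.natGenerator v : PadicAlgCl 2)⁻¹) * (Polynomial.X + 1) ^ (PadicInt.toZModPow (n) (-(Literature.NumberTheory.EllipticCurves.GreenbergVatsal2000.frobeniusExponent 2 (Rat.HeightOneSpectrum.natGenerator v : ℤ_[2])))).val))) (mul_pos h2pos hVpos) hUk hlam₁ hgrowth hE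
    -- (9) read the depleted element as `C 2 ·` the layer sum of the DEPLETED symbols
    haveI : NeZero (2 ^ (n₁ + 2 * j)) := ⟨pow_ne_zero _ two_ne_zero⟩
    rw [depletedCurveLayer_eq_layerSum_depletedSymbol f W (n₁ + 2 * j) S₀ hS2, supNorm_C_mul] at hj
    have hj' := mul_left_cancel₀ h2pos.ne' hj
    obtain ⟨s, hs⟩ := exists_supNorm_sum_C_mul_X_add_one_pow_eq
      (fun s : ZMod (2 ^ (n₁ + 2 * j)) ↦ (∑ k ∈ Fintype.piFinset (fun _ : S₀ ↦ Finset.range 3), (∏ v : S₀, ((W.localPolynomialAt (v : IsDedekindDomain.HeightOneSpectrum (NumberField.RingOfIntegers ℚ))).map (Int.castRingHom (PadicAlgCl 2))).coeff (k v) * ((Rat.HeightOneSpectrum.natGenerator (v : IsDedekindDomain.HeightOneSpectrum (NumberField.RingOfIntegers ℚ)) : PadicAlgCl 2)⁻¹) ^ (k v)) * algebraMap ℚ (PadicAlgCl 2) (ratPlusSymbol f ((((((Literature.NumberTheory.EllipticCurves.cyclotomicGenerator 2 : ZMod (2 ^ (n₁ + 2 * j + 2))) ^ s.val).val : ℚ)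 / (2 : ℚ) ^ (n₁ + 2 * j + 2))) * ((∏ v : S₀, Rat.HeightOneSpectrum.natGenerator (v : IsDedekindDomain.HeightOneSpectrum (NumberField.RingOfIntegers ℚ)) ^ (k v) : ℕ) : ℚ)))))
    refine ⟨n₁ + 2 * j, hn₁e.add (even_two_mul j), s, fun r ↦ ?_⟩
    calc ‖(∑ k ∈ Fintype.piFinset (fun _ : S₀ ↦ Finset.range 3), (∏ v : S₀, ((W.localPolynomialAt (v : IsDedekindDomain.HeightOneSpectrum (NumberField.RingOfIntegers ℚ))).map (Int.castRingHom (PadicAlgCl 2))).coeff (k v) * ((Rat.HeightOneSpectrum.natGenerator (v : IsDedekindDomain.HeightOneSpectrum (NumberField.RingOfIntegers ℚ)) : PadicAlgCl 2)⁻¹) ^ (k v)) * algebraMap ℚ (PadicAlgCl 2) (ratPlusSymbol f (r * ((∏ v : S₀, Rat.HeightOneSpectrum.natGenerator (v : IsDedekindDomain.HeightOneSpectrum (NumberField.RingOfIntegers ℚ)) ^ (k v) : ℕ) : ℚ))))‖ ≤ V := hbound r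
      _ = ‖(∑ k ∈ Fintype.piFinset (fun _ : S₀ ↦ Finset.range 3), (∏ v : S₀, ((W.localPolynomialAt (v : IsDedekindDomain.HeightOneSpectrum (NumberField.RingOfIntegers ℚ))).map (Int.castRingHom (PadicAlgCl 2))).coeff (k v) * ((Rat.HeightOneSpectrum.natGenerator (v : IsDedekindDomain.HeightOneSpectrum (NumberField.RingOfIntegers ℚ)) : PadicAlgCl 2)⁻¹) ^ (k v)) * algebraMap ℚ (PadicAlgCl 2) (ratPlusSymbol f ((((((Literature.NumberTheory.EllipticCurves.cyclotomicGenerator 2 : ZMod (2 ^ (n₁ + 2 * j + 2))) ^ s.val).val : ℚ) / (2 : ℚ) ^ (n₁ + 2 * j + 2))) * ((∏ v : S₀, Rat.HeightOneSpectrum.natGenerator (v : IsDedekindDomain.HeightOneSpectrum (NumberField.RingOfIntegers ℚ)) ^ (k v) : ℕ) : ℚ))))‖ := by rw [← hs]; exact hj'.symm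

end Main

/-! ## §6. THE CRUX BY NAME from the named facts + the `S₀`-free undepleted statement + Deligne -/

section Crux

/-- **THE CRUX `ThetaLayerLambdaCongruenceAtTwo` BY NAME from SIX NAMED FACTS + (PR₂) + DELIGNE.**  Width seat w3 g3's
composition `thetaLayerLambdaCongruenceAtTwo_of_facts_curveMax_deligne` (`…StarCruxGlue`) with its curve-side research input
(μ-W₁) («the `S₀`-DEPLETED rational plus symbol of `W` is `2`-adically maximal at a `2`-power cusp of some even layer», for
every admissible `S₀`) DISCHARGED from the `S₀`-FREE statement (PR₂) «the UNDEPLETED rational plus symbol `[·]⁺_f` of `W`'s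
newform is `2`-adically maximal at a `2`-power cusp `γ^s/2^{n₁+2}` of some even layer `n₁`» (`curveDepletedSymbolMaxAtTwoPowerCusp_of_undepleted`).
(PR₂) is, in Pollack–Weston's cohomological normalisation, `μ(ϑ_{n₁}(f)) = 0` at one even layer: the Perrin-Riou /
Pollack conjecture `μ^± = 0` at the supersingular prime `2` (even branch) for the curve `W` ALONE — OPEN in print; a single
finite modular-symbol computation per curve.  The named facts: `eichlerShimura_depletedOptimalQuotient_periodLattice_of_dvd`,
`WeierstrassCurve.isIsogenous_iff_frobeniusTrace_eq` (Faltings), `mazurKenku_exists_cyclic_isogeny`, `heckeSelfDual_torsionBy_J0`,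
`buzzard2000_multiplicityOne_gamma0`, `serre1972_supersingular_decompositionSubgroup_image`, `Deligne1974_heckeT_eigenvalue_norm_le`.
BSD is not proved by this. [cite: PollackWeston2011MT, Rem. 4.2.1 (conjecture μ^± = 0) and Thm. 4.1]
[cite: GreenbergVatsal2000, §1 (10) and §2 Prop. (2.4) (shape)] -/
theorem thetaLayerLambdaCongruenceAtTwo_of_facts_undepletedMax_deligne
    (hES : eichlerShimura_depletedOptimalQuotient_periodLattice_of_dvd)
    (hF : WeierstrassCurve.isIsogenous_iff_frobeniusTrace_eq) (hMK : mazurKenku_exists_cyclic_isogeny)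
    (hSD : heckeSelfDual_torsionBy_J0) (hBz : buzzard2000_multiplicityOne_gamma0)
    (hSe : serre1972_supersingular_decompositionSubgroup_image)
    (hPR : ∀ (W : WeierstrassCurve ℚ) [W.IsElliptic] [W.IsGloballyMinimal], ¬ W.HasCM → W.analyticRank = 0 → Literature.NumberTheory.EllipticCurves.Rank1Residual.GoodSS W 2 → W.frobeniusTrace 2 = 0 → W.Δ < 0 → ∀ [NeZero (W.conductorNorm ℤ)] (f : CuspForm (CongruenceSubgroup.Gamma0 (W.conductorNorm ℤ)) 2), Literature.NumberTheory.EllipticCurves.ModularForms.IsNewformOf W f → ∃ n₁ : ℕ, Even n₁ ∧ ∃ s : ZMod (2 ^ n₁), ∀ r : ℚ, ‖algebraMap ℚ (PadicAlgCl 2) (ratPlusSymbol f r)‖ ≤ ‖algebraMap ℚ (PadicAlgCl 2) (ratPlusSymbol f ((((Literature.NumberTheory.EllipticCurves.cyclotomicGenerator 2 : ZMod (2 ^ (n₁ + 2))) ^ s.val).val : ℚ) / (2 : ℚ) ^ (n₁ + 2)))‖)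
    (hD : Deligne1974_heckeT_eigenvalue_norm_le) :
    Summit.BirchSwinnertonDyer.BirchSwinnertonDyer.Theses.ResidualThetaTransportAtTwo.ThetaLayerLambdaCongruenceAtTwo :=
  thetaLayerLambdaCongruenceAtTwo_of_facts_curveMax_deligne hES hF hMK hSD hBz hSe
    (curveDepletedSymbolMaxAtTwoPowerCusp_of_undepleted hPR) hD

end Crux

end Summit.BirchSwinnertonDyer.BirchSwinnertonDyer.Theorems.ThetaLayerLambdaCongruenceAtTwo

end
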